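import Mathlib
import Literature.AlgebraicGeometry.Resolution.KollarMaxContactChartsFieldChange
import HarnessLib

/-!
# Crux `Steer` (stmt-ResolutionOfSingularities-16345), chain W4.1, p = 2 T-line, K-input K(3):
# ring-side structure lemmas for isolated radicand chains, I — (B0) order ≥ 2 kills regularity at any prime,
# (B1) the non-isolatedness criterion

OURS (campaign `res-hironaka`, rung L ★L-G4, slot W4.1; seat res-type-096 g8, FREE named-reserve hand under
res-D-plan-1 ROUTING #14 (d), OFFER 2026-08-27T07:13:37Z; replaces the role of no printed item; NOT a statement of the
manuscript under review; AI-produced, weaker than expert review). Object: the K-input of record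
`NoEternalIsolatedRadicandChainFinrank p c e` (idea-1 §σ2.13b; CHAIN v5.8 §A2/§D, K(3) = `∀ p prime, … p 3 1`, FRONTIER):
its isolatedness binder reads «every non-maximal prime `Q` of the radicand ring `S[X]/(X^p − f)` has a regular
localisation». This file proves the kernel form of «the radicand hypersurface is singular along the subvariety `V(𝔮)`»
(companion of the closed-point lemma `RadicandChainTwo.not_isRegularLocalRing_of_sub_pow_mem_sq`, p502783, which is the
case `𝔮 = 𝔪`; here `𝔮` is a NON-maximal prime, which is what the isolatedness binder quantifies over, and what the
multiplicity clause `m(y) = m(x)` of Hironaka-permissibility (Cossart–Piltant 2019 Def. 2.7 (i)) reads at a non-closed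
point `y` — res-L0-w41-lead-1 FINDING 2026-08-27T07:05:06Z «the only Hironaka-permissible centre at an isolated singular
point is the closed point»):

* `RadicandChain.not_isRegularLocalRing_localization_atPrime_quotient_of_mem_sq` — **(B0)** for a regular domain `T`,
  `0 ≠ h ∈ T` and a prime `Q` of `T/(h)` whose preimage `Q̃` in `T` has `h ∈ Q̃²`, the localisation `(T/(h))_Q ≅ T_{Q̃}/(h)`
  is NOT regular (converse of Matsumura 14.2);
* `RadicandChain.exists_nonmaximal_not_isRegularLocalRing_of_sub_pow_mem_sq` — **(B1)** if `S` is a regular domain of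
  characteristic `p`, `𝔮` a NON-maximal
  prime of `S` and `f − h^p ∈ 𝔮²` for some `h` (`2 ≤ p`), then the prime `Q = (𝔮, X − h)` of `S[X]/(X^p − f)` is
  non-maximal and its localisation is NOT regular: `X^p − f = (X − h)^p − (f − h^p)` lies in the square of the maximal
  ideal of the regular local ring `S[X]_{(𝔮, X−h)}`, and a regular local ring modulo a non-zero element of `𝔪²` is never
  regular (`notMem_sq_of_isRegularLocalRing_quotient`, Matsumura 14.2);
* `RadicandChain.sub_pow_not_mem_sq_of_isolated` — the contrapositive against the VERBATIM isolatedness binder of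
  `NoEternalIsolatedRadicandChainFinrank`: isolated radicand singularity ⇒ `f − h^p ∉ 𝔮²` for all non-maximal `𝔮`, all `h`.
Sequel (B2, no exceptional factor / cleaned order exactly `p` along the chain):
`FrobeniusClosingSteerRadicandChainNoExcFactor.lean`.

[cite: Matsumura1987, Thm. 14.2] [folklore]
-/

noncomputable section

-- `Summit.<S>.<S>.…` duplicates the summit name by design (single-problem summit).
set_option linter.dupNamespace false

open Polynomial IsLocalRing

namespace Summit.ResolutionOfSingularities.ResolutionOfSingularities.Theorems.SwitchingDichotomy

namespace RadicandChain

universe u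

variable {S : Type u} [CommRing S]

/-! ## (B1) The prime `(𝔮, X − h)` of the radicand ring -/

section B1

variable (p : ℕ) (f h : S) (𝔮 : Ideal S)

/-- For the evaluation `S[X] → S/𝔮`, `X ↦ h` (kernel = the prime `(𝔮, X − h)`): `C s ∈ ker ↔ s ∈ 𝔮`. [folklore] -/
theorem C_mem_ker_evalQuot_iff (s : S) : C s ∈ RingHom.ker ((Ideal.Quotient.mk 𝔮).comp (evalRingHom h)) ↔ s ∈ 𝔮 := by
  rw [RingHom.mem_ker, RingHom.comp_apply, coe_evalRingHom, eval_C, Ideal.Quotient.eq_zero_iff_mem]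

/-- `X − C h` lies in the kernel of `S[X] → S/𝔮`, `X ↦ h`. [folklore] -/
theorem X_sub_C_mem_ker_evalQuot : X - C h ∈ RingHom.ker ((Ideal.Quotient.mk 𝔮).comp (evalRingHom h)) := by
  rw [RingHom.mem_ker, RingHom.comp_apply, coe_evalRingHom, eval_sub, eval_X, eval_C, sub_self, map_zero]

/-- `𝔮·S[X]` lies in the kernel of `S[X] → S/𝔮`, `X ↦ h`. [folklore] -/
theorem map_C_le_ker_evalQuot : 𝔮.map (C : S →+* S[X]) ≤ RingHom.ker ((Ideal.Quotient.mk 𝔮).comp (evalRingHom h)) := by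
  rw [Ideal.map_le_iff_le_comap]
  intro s hs
  exact (C_mem_ker_evalQuot_iff h 𝔮 s).mpr hs

/-- In characteristic `p`: if `f − h^p ∈ 𝔮²` then `X^p − f = (X − h)^p − (f − h^p)` lies in the SQUARE of the prime
`(𝔮, X − h)` of `S[X]` (`p ≥ 2`). [folklore] -/
theorem X_pow_sub_C_mem_ker_sq [hp : Fact p.Prime] [CharP S p] (hf : f - h ^ p ∈ 𝔮 ^ 2) :
    (X : S[X]) ^ p - C f ∈ RingHom.ker ((Ideal.Quotient.mk 𝔮).comp (evalRingHom h)) ^ 2 := by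
  have h2 : 2 ≤ p := hp.out.two_le
  have e : (X : S[X]) ^ p - C f = (X - C h) ^ p - C (f - h ^ p) := by
    have e1 : ((X : S[X]) - C h) ^ p = X ^ p - C h ^ p := sub_pow_char_of_commute p (Commute.all _ _)
    rw [e1, map_sub, map_pow]
    ring
  rw [e]
  refine Ideal.sub_mem _ ?_ ?_
  · exact Ideal.pow_le_pow_right h2 (Ideal.pow_mem_pow (X_sub_C_mem_ker_evalQuot h 𝔮) p)
  · have : C (f - h ^ p) ∈ (𝔮 ^ 2).map (C : S →+* S[X]) := Ideal.mem_map_of_mem _ hf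
    rw [Ideal.map_pow] at this
    exact Ideal.pow_right_mono (map_C_le_ker_evalQuot h 𝔮) 2 this

end B1

/-! ## (B0) A hypersurface ring is not regular at a prime where the equation has order `≥ 2` -/

section B0

variable {T : Type u} [CommRing T] [IsDomain T] [IsRegularRing T]

/-- **(B0) Order `≥ 2` kills regularity, at any prime.** Let `T` be a regular domain, `0 ≠ h ∈ T`, and `Q` a prime of
the hypersurface ring `T/(h)` such that `h` lies in the SQUARE of the corresponding prime `Q̃` of `T`. Then the
localisation `(T/(h))_Q ≅ T_{Q̃}/(h)` is NOT a regular local ring: `T_{Q̃}` is regular local, `h ≠ 0` lies in the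
square of its maximal ideal, and the converse of Matsumura 14.2
(`Literature.AlgebraicGeometry.Resolution.notMem_sq_of_isRegularLocalRing_quotient`) forbids a regular quotient. This
is the kernel form of «`m(y) ≥ 2` makes `𝒪_{𝒳,y}` singular» for a hypersurface `𝒳 = V(h)` in a regular scheme (the
multiplicity clause of Hironaka-permissibility, Cossart–Piltant 2019 Def. 2.7 (i), read at a non-closed point).
[cite: Matsumura1987, Thm. 14.2] [folklore] -/
theorem not_isRegularLocalRing_localization_atPrime_quotient_of_mem_sq {h : T} (h0 : h ≠ 0)
    (Q : Ideal (T ⧸ Ideal.span {h})) [Q.IsPrime]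
    (hQ : h ∈ Q.comap (Ideal.Quotient.mk (Ideal.span {h})) ^ 2) :
    ¬ IsRegularLocalRing (Localization.AtPrime Q) := by
  classical
  intro hreg
  let mk : T →+* T ⧸ Ideal.span {h} := Ideal.Quotient.mk (Ideal.span {h})
  set Qt : Ideal T := Q.comap mk with hQt
  haveI hQtp : Qt.IsPrime := Ideal.comap_isPrime mk Q
  have hJQt : Ideal.span {h} ≤ Qt := by
    rw [hQt, ← Ideal.map_le_iff_le_comap, Ideal.map_quotient_self]; exact bot_le
  have hgQt : h ∈ Qt := hJQt (Ideal.mem_span_singleton_self h)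
  set A := Localization.AtPrime Qt with hA
  set t : A := algebraMap T A h with ht
  have hmemQ : ∀ c : T, mk c ∈ Q ↔ c ∈ Qt := fun c => by rw [hQt, Ideal.mem_comap]
  have hM : Algebra.algebraMapSubmonoid (T ⧸ Ideal.span {h}) Qt.primeCompl = Q.primeCompl := by
    ext b
    constructor
    · rintro ⟨c, hc, rfl⟩
      exact fun h' => hc ((hmemQ c).mp h')
    · intro hb
      obtain ⟨c, rfl⟩ := Ideal.Quotient.mk_surjective b
      exact ⟨c, fun h' => hb ((hmemQ c).mpr h'), rfl⟩
  -- `(T/(h))_Q ≅ A / h A`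
  haveI : IsLocalization.AtPrime (A ⧸ (Ideal.span {h}).map (algebraMap T A)) Q := by
    have := (inferInstance : IsLocalization (Algebra.algebraMapSubmonoid (T ⧸ Ideal.span {h}) Qt.primeCompl)
      (A ⧸ (Ideal.span {h}).map (algebraMap T A)))
    rwa [hM] at this
  have e := (IsLocalization.algEquiv Q.primeCompl (A ⧸ (Ideal.span {h}).map (algebraMap T A))
    (Localization.AtPrime Q)).toRingEquiv
  haveI hreg1 : IsRegularLocalRing (A ⧸ (Ideal.span {h}).map (algebraMap T A)) :=
    @IsRegularLocalRing.of_ringEquiv (Localization.AtPrime Q) _ hreg _ _ e.symm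
  have hJt : (Ideal.span {h}).map (algebraMap T A) = Ideal.span {t} := by
    rw [Ideal.map_span, Set.image_singleton]
  haveI hreg2 : IsRegularLocalRing (A ⧸ Ideal.span {t}) :=
    @IsRegularLocalRing.of_ringEquiv (A ⧸ (Ideal.span {h}).map (algebraMap T A)) _ hreg1 _ _ (Ideal.quotEquivOfEq hJt)
  -- `A` is regular local, `t ∈ 𝔪_A² ∖ {0}`
  haveI : IsRegularLocalRing A := IsRegularRing.isRegularLocalRing_localization Qt
  have htm : t ∈ maximalIdeal A := by
    rw [← Localization.AtPrime.map_eq_maximalIdeal]; exact Ideal.mem_map_of_mem _ hgQt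
  have ht0 : t ≠ 0 := by
    intro e0
    apply h0
    have hinj : Function.Injective (algebraMap T A) := IsLocalization.injective A Qt.primeCompl_le_nonZeroDivisors
    exact hinj (by rw [map_zero]; exact e0)
  have ht2 : t ∈ maximalIdeal A ^ 2 := by
    rw [← Localization.AtPrime.map_eq_maximalIdeal, ← Ideal.map_pow]
    exact Ideal.mem_map_of_mem _ hQ
  exact Literature.AlgebraicGeometry.Resolution.notMem_sq_of_isRegularLocalRing_quotient htm ht0 ht2

end B0

/-! ## (B1) Non-regularity of the radicand ring at `(𝔮, X − h)` -/

section B1main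

variable (p : ℕ) [hp : Fact p.Prime] [CharP S p] [IsDomain S] [IsRegularRing S]

/-- **(B1) Non-isolatedness criterion for radicand rings.** Let `S` be a regular domain of characteristic `p`, `𝔮` a
prime of `S` which is not maximal, and `f, h ∈ S` with `f − h^p ∈ 𝔮²`. Then the prime `Q` of the radicand ring
`S[X]/(X^p − f)` lying under `(𝔮, X − h)` is not maximal and the localisation at `Q` is NOT a regular local ring: the
defining element `X^p − f = (X − h)^p − (f − h^p)` lies in the square of the maximal ideal of the regular local ring
`S[X]_{(𝔮, X − h)}`, and the quotient of a regular local ring by a non-zero element of `𝔪²` is not regular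
(`Literature.AlgebraicGeometry.Resolution.notMem_sq_of_isRegularLocalRing_quotient`). Stated against the VERBATIM
isolatedness binder of `NoEternalIsolatedRadicandChainFinrank`. [cite: Matsumura1987, Thm. 14.2] [folklore] -/
theorem exists_nonmaximal_not_isRegularLocalRing_quotient_of_sub_pow_mem_sq (f h : S) (𝔮 : Ideal S)
    [𝔮.IsPrime] (hmax : ¬ 𝔮.IsMaximal) (hf : f - h ^ p ∈ 𝔮 ^ 2) :
    ∃ (Q : Ideal (S[X] ⧸ Ideal.span {(X : S[X]) ^ p - C f})) (_ : Q.IsPrime),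
      (∃ Q' : Ideal (S[X] ⧸ Ideal.span {(X : S[X]) ^ p - C f}), Q'.IsPrime ∧ Q < Q') ∧
      ¬ IsRegularLocalRing (Localization.AtPrime Q) := by
  classical
  set g : S[X] := (X : S[X]) ^ p - C f with hg
  set J : Ideal S[X] := Ideal.span {g} with hJ
  -- the prime `Q̃ = (𝔮, X − h)` of `S[X]` and a maximal `𝔪 > 𝔮`
  set Qt : Ideal S[X] := RingHom.ker ((Ideal.Quotient.mk 𝔮).comp (evalRingHom h)) with hQt
  haveI hQtp : Qt.IsPrime := RingHom.ker_isPrime _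
  have hgQt : g ∈ Qt := Ideal.pow_le_self two_ne_zero (X_pow_sub_C_mem_ker_sq p f h 𝔮 hf)
  have hJQt : J ≤ Qt := (Ideal.span_singleton_le_iff_mem _).mpr hgQt
  obtain ⟨𝔪, h𝔪max, h𝔮𝔪⟩ := Ideal.exists_le_maximal 𝔮 (Ideal.IsPrime.ne_top inferInstance)
  have hne : 𝔮 ≠ 𝔪 := fun e => hmax (e ▸ h𝔪max)
  obtain ⟨s, hs𝔪, hs𝔮⟩ : ∃ s ∈ 𝔪, s ∉ 𝔮 := SetLike.exists_of_lt (lt_of_le_of_ne h𝔮𝔪 hne)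
  set Mt : Ideal S[X] := RingHom.ker ((Ideal.Quotient.mk 𝔪).comp (evalRingHom h)) with hMt
  haveI hMtp : Mt.IsPrime := by
    haveI := h𝔪max.isPrime
    exact RingHom.ker_isPrime _
  have hQM : Qt < Mt := by
    refine lt_of_le_of_ne ?_ ?_
    · intro q hq
      rw [hMt, RingHom.mem_ker, RingHom.comp_apply]
      rw [hQt, RingHom.mem_ker, RingHom.comp_apply, Ideal.Quotient.eq_zero_iff_mem] at hq
      exact (Ideal.Quotient.eq_zero_iff_mem).mpr (h𝔮𝔪 hq)
    · intro e
      have : C s ∈ Qt := by rw [e]; exact (C_mem_ker_evalQuot_iff h 𝔪 s).mpr hs𝔪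
      exact hs𝔮 ((C_mem_ker_evalQuot_iff h 𝔮 s).mp this)
  -- push down to the radicand ring `S[X]/J`
  let mk : S[X] →+* S[X] ⧸ J := Ideal.Quotient.mk J
  have hmk : Function.Surjective mk := Ideal.Quotient.mk_surjective
  have hker : RingHom.ker mk = J := Ideal.mk_ker
  set Q : Ideal (S[X] ⧸ J) := Qt.map mk with hQ
  set Q' : Ideal (S[X] ⧸ J) := Mt.map mk with hQ'
  have hcQ : Q.comap mk = Qt := by
    rw [hQ, Ideal.comap_map_of_surjective _ hmk, ← RingHom.ker_eq_comap_bot, hker, sup_eq_left]; exact hJQt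
  have hcQ' : Q'.comap mk = Mt := by
    rw [hQ', Ideal.comap_map_of_surjective _ hmk, ← RingHom.ker_eq_comap_bot, hker, sup_eq_left]
    exact hJQt.trans hQM.le
  haveI hQp : Q.IsPrime := Ideal.map_isPrime_of_surjective hmk (by rw [hker]; exact hJQt)
  haveI hQ'p : Q'.IsPrime := Ideal.map_isPrime_of_surjective hmk (by rw [hker]; exact hJQt.trans hQM.le)
  refine ⟨Q, hQp, ⟨Q', hQ'p, ?_⟩, ?_⟩
  · refine lt_of_le_of_ne (Ideal.map_mono hQM.le) fun e => ?_
    exact hQM.ne (by rw [← hcQ, ← hcQ', e])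
  -- `(S[X]/J)_Q ≅ S[X]_{Q̃} / g` with `g ∈ Q̃² ∖ {0}`: not regular by (B0)
  have hg0 : g ≠ 0 := (monic_X_pow_sub_C f hp.out.ne_zero).ne_zero
  refine not_isRegularLocalRing_localization_atPrime_quotient_of_mem_sq hg0 Q ?_
  rw [show Q.comap (Ideal.Quotient.mk (Ideal.span {g})) = Qt from hcQ]
  exact X_pow_sub_C_mem_ker_sq p f h 𝔮 hf

/-- **(B1) Non-isolatedness criterion for radicand rings**, `AdjoinRoot` form (the radicand ring of idea-1's
`RadicandRing S p f := AdjoinRoot (X ^ p − C f)`, as unfolded in the isolatedness binder of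
`NoEternalIsolatedRadicandChainFinrank`): for a regular domain `S` of characteristic `p`, a non-maximal prime `𝔮` and
`f − h^p ∈ 𝔮²`, some non-maximal prime of `S[X]/(X^p − f)` (namely the one under `(𝔮, X − h)`) has a NON-regular
localisation — so `f` violates the isolatedness binder. [cite: Matsumura1987, Thm. 14.2] [folklore] -/
theorem exists_nonmaximal_not_isRegularLocalRing_of_sub_pow_mem_sq (f h : S) (𝔮 : Ideal S) [𝔮.IsPrime]
    (hmax : ¬ 𝔮.IsMaximal) (hf : f - h ^ p ∈ 𝔮 ^ 2) :
    ∃ (Q : Ideal (AdjoinRoot ((X : S[X]) ^ p - C f))) (_ : Q.IsPrime),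
      (∃ Q' : Ideal (AdjoinRoot ((X : S[X]) ^ p - C f)), Q'.IsPrime ∧ Q < Q') ∧
      ¬ IsRegularLocalRing (Localization.AtPrime Q) :=
  exists_nonmaximal_not_isRegularLocalRing_quotient_of_sub_pow_mem_sq p f h 𝔮 hmax hf

/-- **(B1), contrapositive packaged for the chain**: if the radicand ring `S[X]/(X^p − f)` of a regular domain `S` of
characteristic `p` satisfies the isolatedness binder of `NoEternalIsolatedRadicandChainFinrank` («every non-maximal prime
has a regular localisation»), then `f − h^p ∉ 𝔮²` for every non-maximal prime `𝔮` and every `h`.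
[cite: Matsumura1987, Thm. 14.2] [folklore] -/
theorem sub_pow_not_mem_sq_of_isolated (f : S)
    (hisol : ∀ (Q : Ideal (AdjoinRoot ((X : S[X]) ^ p - C f))) [Q.IsPrime],
      (∃ Q' : Ideal (AdjoinRoot ((X : S[X]) ^ p - C f)), Q'.IsPrime ∧ Q < Q') →
      IsRegularLocalRing (Localization.AtPrime Q))
    (𝔮 : Ideal S) [𝔮.IsPrime] (hmax : ¬ 𝔮.IsMaximal) (h : S) : f - h ^ p ∉ 𝔮 ^ 2 := by
  intro hf
  obtain ⟨Q, hQ, hQ', hreg⟩ := exists_nonmaximal_not_isRegularLocalRing_of_sub_pow_mem_sq p f h 𝔮 hmax hf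
  exact hreg (hisol Q hQ')

end B1main

/-! ## (B0′) The same with the order hypothesis read in the local ring (symbolic square) -/

section B0loc

variable {T : Type u} [CommRing T] [IsDomain T] [IsRegularRing T]

/-- **(B0′) Order `≥ 2` AT `y` kills regularity at `y`** — the hypothesis of (B0) read in the local ring `T_{Q̃}` (i.e.
`h ∈ Q̃⁽²⁾`, the symbolic square; this is literally «`m(y) = ord_{𝔪_{T_y}} h ≥ 2`» of Cossart–Piltant 2019 p.9/Def. 2.7
(i) for the hypersurface `V(h)` at the point `y = Q̃`): then `(T/(h))_Q` is not a regular local ring.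
[cite: Matsumura1987, Thm. 14.2] [folklore] -/
theorem not_isRegularLocalRing_localization_atPrime_quotient_of_mem_sq_atPrime {h : T} (h0 : h ≠ 0)
    (Q : Ideal (T ⧸ Ideal.span {h})) [Q.IsPrime]
    (hQ : algebraMap T (Localization.AtPrime (Q.comap (Ideal.Quotient.mk (Ideal.span {h})))) h ∈
      maximalIdeal (Localization.AtPrime (Q.comap (Ideal.Quotient.mk (Ideal.span {h})))) ^ 2) :
    ¬ IsRegularLocalRing (Localization.AtPrime Q) := by
  classical
  intro hreg
  let mk : T →+* T ⧸ Ideal.span {h} := Ideal.Quotient.mk (Ideal.span {h})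
  set Qt : Ideal T := Q.comap mk with hQt
  haveI hQtp : Qt.IsPrime := Ideal.comap_isPrime mk Q
  have hJQt : Ideal.span {h} ≤ Qt := by
    rw [hQt, ← Ideal.map_le_iff_le_comap, Ideal.map_quotient_self]; exact bot_le
  have hgQt : h ∈ Qt := hJQt (Ideal.mem_span_singleton_self h)
  set A := Localization.AtPrime Qt with hA
  set t : A := algebraMap T A h with ht
  have hmemQ : ∀ c : T, mk c ∈ Q ↔ c ∈ Qt := fun c => by rw [hQt, Ideal.mem_comap]
  have hM : Algebra.algebraMapSubmonoid (T ⧸ Ideal.span {h}) Qt.primeCompl = Q.primeCompl := by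
    ext b
    constructor
    · rintro ⟨c, hc, rfl⟩
      exact fun h' => hc ((hmemQ c).mp h')
    · intro hb
      obtain ⟨c, rfl⟩ := Ideal.Quotient.mk_surjective b
      exact ⟨c, fun h' => hb ((hmemQ c).mpr h'), rfl⟩
  haveI : IsLocalization.AtPrime (A ⧸ (Ideal.span {h}).map (algebraMap T A)) Q := by
    have := (inferInstance : IsLocalization (Algebra.algebraMapSubmonoid (T ⧸ Ideal.span {h}) Qt.primeCompl)
      (A ⧸ (Ideal.span {h}).map (algebraMap T A)))
    rwa [hM] at this
  have e := (IsLocalization.algEquiv Q.primeCompl (A ⧸ (Ideal.span {h}).map (algebraMap T A))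
    (Localization.AtPrime Q)).toRingEquiv
  haveI hreg1 : IsRegularLocalRing (A ⧸ (Ideal.span {h}).map (algebraMap T A)) :=
    @IsRegularLocalRing.of_ringEquiv (Localization.AtPrime Q) _ hreg _ _ e.symm
  have hJt : (Ideal.span {h}).map (algebraMap T A) = Ideal.span {t} := by
    rw [Ideal.map_span, Set.image_singleton]
  haveI hreg2 : IsRegularLocalRing (A ⧸ Ideal.span {t}) :=
    @IsRegularLocalRing.of_ringEquiv (A ⧸ (Ideal.span {h}).map (algebraMap T A)) _ hreg1 _ _ (Ideal.quotEquivOfEq hJt)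
  haveI : IsRegularLocalRing A := IsRegularRing.isRegularLocalRing_localization Qt
  have htm : t ∈ maximalIdeal A := by
    rw [← Localization.AtPrime.map_eq_maximalIdeal]; exact Ideal.mem_map_of_mem _ hgQt
  have ht0 : t ≠ 0 := by
    intro e0
    apply h0
    have hinj : Function.Injective (algebraMap T A) := IsLocalization.injective A Qt.primeCompl_le_nonZeroDivisors
    exact hinj (by rw [map_zero]; exact e0)
  exact Literature.AlgebraicGeometry.Resolution.notMem_sq_of_isRegularLocalRing_quotient htm ht0 hQ

end B0loc

end RadicandChain

end Summit.ResolutionOfSingularities.ResolutionOfSingularities.Theorems.SwitchingDichotomy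

end
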